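import Mathlib
import HarnessLib

/-!
# Crux `BirComplexStableXYR`, line `fat-gaussian-defect-calculus`: stub T3 `stub_dressedEigenvectors`

Registered stub (lead c8, wave 12, chapter T-end, skeleton
`Cruxes/BirComplexStableXYR/Lines/fat_gaussian_defect_calculus.lean`), helper (`--supports`) for the crux
`Summit.HubbardSuperconductivity.HubbardSuperconductivity.Theses.BalabanIR.BirComplexStableXYR`:
**dressed right and left eigenvectors of a bounded operator with a dominant rank-one idempotent**
(generic functional analysis; pure algebra in the ring `E →L[ℂ] E` of bounded operators, no project definitions).

**Statement.** Let `E` be a complex Banach space, `t : E →L[ℂ] E`, `e : E`, `φ : E →L[ℂ] ℂ` with `φ e = 1`, so that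
`p₀ := φ(·)e = φ.smulRight e` is a rank-one idempotent; put `q₀ := 1 − p₀`, `M := q₀ t q₀`, and let `μ ≠ 0` be such that
`μ − M` is a unit, `R := (μ − M)⁻¹` (`Ring.inverse`), with `μ` solving the Feshbach (Schur-complement) equation
`μ = a + b (R c)` for the block data `a := φ (t e)`, `b := φ ∘ t ∘ q₀`, `c := q₀ (t e)`.  Then `x := e + R c` satisfies
`t x = μ x`, `ψ := φ + b ∘ R` satisfies `ψ ∘ t = μ ψ`, and `ψ x = 1 + b (R (R c))`.

**Proof.** Elementary bookkeeping from `φ e = 1`, `μ ≠ 0` and the two inverse identities `R (μ − M) = 1`,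
`(μ − M) R = 1` (evaluated at vectors): `q₀ e = 0`, `φ ∘ q₀ = 0`, `q₀² = q₀`; `M e = 0` hence `R e = μ⁻¹ e`; `b e = 0`;
`φ c = 0` and `φ ∘ M = 0` hence `φ (R c) = 0`, i.e. `q₀ (R c) = R c`; `R M = μ R − 1` and `M (R c) = μ R c − c`.
Then `t x = (a + b(Rc)) e + μ R c = μ x`; for every `y`, `ψ (t y) = φy·a + b y + φy·b(Rc) + μ b(Ry) − b y = μ ψ y`
(decompose `y = φy·e + q₀ y`, `t = p₀ t + q₀ t`); and `ψ x = φ e + φ(Rc) + μ⁻¹ b e + b(R(Rc)) = 1 + b(R(Rc))`.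
The algebra is isolated in `hsc_dressed_core`, stated for opaque `q₀, R, b, c` with their defining equations, and
the registered signature follows by `Ring.inverse_mul_cancel` / `Ring.mul_inverse_cancel`.  Mathlib only; no
definition and no named fact is introduced; sorry-free. [folklore]
-/

set_option linter.dupNamespace false -- `Summit.<S>.<S>.Theorems…` repeats the summit name (D-0017 layout)

namespace Summit.HubbardSuperconductivity.HubbardSuperconductivity.Theorems.TEnd

section Core

variable {E : Type*} [NormedAddCommGroup E] [NormedSpace ℂ E]

/-- **Core algebra of the dressed eigenvectors.**  For opaque `q₀ = 1 − φ(·)e`, a two-sided inverse `R` of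
`μ • 1 − q₀ t q₀`, `b = φ ∘ t ∘ q₀`, `c = q₀ (t e)`, with `φ e = 1`, `μ ≠ 0` and the Feshbach equation
`μ = φ (t e) + b (R c)`: `t (e + R c) = μ • (e + R c)`, `(φ + b ∘ R) ∘ t = μ • (φ + b ∘ R)` and
`(φ + b ∘ R) (e + R c) = 1 + b (R (R c))`. [folklore] -/
theorem hsc_dressed_core (t : E →L[ℂ] E) (e : E) (φ : E →L[ℂ] ℂ) (hφ : φ e = 1) (μ : ℂ) (hμ : μ ≠ 0)
    (q₀ : E →L[ℂ] E) (hq : q₀ = (1 : E →L[ℂ] E) - φ.smulRight e)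
    (R : E →L[ℂ] E) (hR1 : R * (μ • (1 : E →L[ℂ] E) - q₀ * t * q₀) = 1)
    (hR2 : (μ • (1 : E →L[ℂ] E) - q₀ * t * q₀) * R = 1)
    (b : E →L[ℂ] ℂ) (hb : b = φ.comp (t * q₀)) (c : E) (hc : c = q₀ (t e))
    (hfix : μ = φ (t e) + b (R c)) :
    t (e + R c) = μ • (e + R c) ∧ (φ + b.comp R).comp t = μ • (φ + b.comp R) ∧
      (φ + b.comp R) (e + R c) = 1 + b (R (R c)) := by
  /- (i) the complementary idempotent `q₀ = 1 - φ(·)e` -/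
  have hq₀y : ∀ y, q₀ y = y - φ y • e := fun y => by
    simp [hq, ContinuousLinearMap.smulRight_apply]
  have hφq : ∀ y, φ (q₀ y) = 0 := fun y => by
    rw [hq₀y, map_sub, map_smul, hφ, smul_eq_mul, mul_one, sub_self]
  have hq₀e : q₀ e = 0 := by rw [hq₀y, hφ, one_smul, sub_self]
  have hdec : ∀ y, φ y • e + q₀ y = y := fun y => by rw [hq₀y]; abel
  have hby : ∀ y, b y = φ (t (q₀ y)) := fun y => by simp [hb]
  have hbe : b e = 0 := by rw [hby, hq₀e, map_zero, map_zero]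
  /- (ii) the two inverse identities, evaluated at vectors -/
  have hR1y : ∀ y, μ • R y - R (q₀ (t (q₀ y))) = y := fun y => by
    have h := congrArg (fun f : E →L[ℂ] E => f y) hR1
    simpa using h
  have hR2y : ∀ y, μ • R y - q₀ (t (q₀ (R y))) = y := fun y => by
    have h := congrArg (fun f : E →L[ℂ] E => f y) hR2
    simpa using h
  -- `R M = μ R - 1`
  have hRM : ∀ y, R (q₀ (t (q₀ y))) = μ • R y - y := fun y => by
    have h := hR1y y
    linear_combination (norm := module) -h
  -- `M e = 0`, hence `R e = μ⁻¹ e`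
  have hRe : R e = μ⁻¹ • e := by
    have h := hR1y e
    rw [hq₀e, map_zero, map_zero, map_zero, sub_zero] at h
    calc R e = μ⁻¹ • (μ • R e) := by rw [smul_smul, inv_mul_cancel₀ hμ, one_smul]
      _ = μ⁻¹ • e := by rw [h]
  -- `φ c = 0`, `φ ∘ M = 0`, hence `φ (R c) = 0` and `q₀ (R c) = R c`
  have hφRc : φ (R c) = 0 := by
    have h := congrArg φ (hR2y c)
    have hφc : φ c = 0 := by rw [hc]; exact hφq _
    simp only [map_sub, map_smul, hφq, hφc, smul_eq_mul, sub_zero] at h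
    exact (mul_eq_zero.mp h).resolve_left hμ
  have hRc : q₀ (R c) = R c := by rw [hq₀y (R c), hφRc, zero_smul, sub_zero]
  -- `M (R c) = μ R c - c`
  have hMRc : q₀ (t (q₀ (R c))) = μ • R c - c := by
    have h := hR2y c
    linear_combination (norm := module) -h
  /- (iii) block decompositions of `t e`, `t (R c)`, `R (t e)`, `R (t (q₀ y))` -/
  have hte : t e = φ (t e) • e + c := by rw [hc]; exact (hdec _).symm
  have htRc : t (R c) = b (R c) • e + (μ • R c - c) := by
    rw [← hMRc, hby, hRc]
    exact (hdec _).symm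
  have hRte : R (t e) = (φ (t e) * μ⁻¹) • e + R c := by
    conv_lhs => rw [hte]
    rw [map_add, map_smul, hRe, smul_smul]
  have hRtq : ∀ y, R (t (q₀ y)) = (b y * μ⁻¹) • e + (μ • R y - y) := fun y => by
    conv_lhs => rw [← hdec (t (q₀ y))]
    rw [map_add, map_smul, hRe, hRM, smul_smul, ← hby]
  /- (1) the right eigenvector -/
  have h1 : t (e + R c) = μ • (e + R c) := by
    rw [map_add, hte, htRc, smul_add]
    linear_combination (norm := module) hfix.symm • e
  /- (2) the left eigenvector -/
  have h2 : (φ + b.comp R).comp t = μ • (φ + b.comp R) := by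
    ext y
    have hty : t y = φ y • t e + t (q₀ y) := by
      conv_lhs => rw [← hdec y]
      rw [map_add, map_smul]
    have hφty : φ (t y) = φ y * φ (t e) + b y := by
      rw [hty, map_add, map_smul, smul_eq_mul, ← hby]
    have hRty : R (t y) = (φ y * (φ (t e) * μ⁻¹) + b y * μ⁻¹) • e + φ y • R c + (μ • R y - y) := by
      rw [hty, map_add, map_smul, hRte, hRtq]
      module
    have hbRty : b (R (t y)) = φ y * b (R c) + (μ * b (R y) - b y) := by
      have h := congrArg b hRty
      simp only [map_add, map_sub, map_smul, hbe, smul_eq_mul] at h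
      linear_combination h
    simp only [ContinuousLinearMap.comp_apply, add_apply, smul_apply, smul_eq_mul]
    linear_combination hφty + hbRty - φ y * hfix
  /- (3) the normalisation -/
  have h3 : (φ + b.comp R) (e + R c) = 1 + b (R (R c)) := by
    have e1 : (φ + b.comp R) (e + R c) = φ e + b (R e) + (φ (R c) + b (R (R c))) := by
      simp only [add_apply, ContinuousLinearMap.comp_apply, map_add]
    rw [e1, hφ, hφRc, hRe, map_smul, hbe, smul_zero, add_zero, zero_add]
  exact ⟨h1, h2, h3⟩

end Core

/-- **stub T3 (M, generic; pure algebra): dressed right and left eigenvectors.**  With the rank-one idempotent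
`p₀ = φ(·)e` (`φ e = 1`), `q₀ = 1 − p₀`, and `μ ≠ 0` solving the Feshbach equation for the block data of `t`
(`a = φ(te)`, `b = φ∘t∘q₀`, `c = q₀te`, `M = q₀tq₀`, `R = (μ − M)⁻¹`): `x = e + Rc` satisfies `t x = μx`,
`ψ = φ + b∘R` satisfies `ψ∘t = μψ`, and `ψ(x) = 1 + b(R(Rc))` (`p₀q₀ = 0`, `Me = 0` so `Re = e/μ`, `be = 0`,
`p₀c = 0`, `p₀M = 0` so `φ(Rc) = 0`; `RM = μR − 1`).  Reduced to `hsc_dressed_core` via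
`Ring.inverse_mul_cancel` / `Ring.mul_inverse_cancel`. [folklore] -/
theorem stub_dressedEigenvectors :
    ∀ (E : Type) [NormedAddCommGroup E] [NormedSpace ℂ E] [CompleteSpace E]
      (t : E →L[ℂ] E) (e : E) (φ : E →L[ℂ] ℂ), φ e = 1 →
      ∀ (μ : ℂ), μ ≠ 0 →
        IsUnit (μ • (1 : E →L[ℂ] E) - ((1 : E →L[ℂ] E) - φ.smulRight e) * t * ((1 : E →L[ℂ] E) - φ.smulRight e)) →
        μ = φ (t e) + (φ.comp (t * ((1 : E →L[ℂ] E) - φ.smulRight e)))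
              (Ring.inverse (μ • (1 : E →L[ℂ] E) - ((1 : E →L[ℂ] E) - φ.smulRight e) * t * ((1 : E →L[ℂ] E) - φ.smulRight e))
                (((1 : E →L[ℂ] E) - φ.smulRight e) (t e))) →
        let q₀ : E →L[ℂ] E := (1 : E →L[ℂ] E) - φ.smulRight e
        let R : E →L[ℂ] E := Ring.inverse (μ • (1 : E →L[ℂ] E) - q₀ * t * q₀)
        let x : E := e + R (q₀ (t e))
        let ψ : E →L[ℂ] ℂ := φ + (φ.comp (t * q₀)).comp R
        t x = μ • x ∧ ψ.comp t = μ • ψ ∧ ψ x = 1 + (φ.comp (t * q₀)) (R (R (q₀ (t e)))) := by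
  intro E _ _ _ t e φ hφ μ hμ hU hfix
  exact hsc_dressed_core t e φ hφ μ hμ ((1 : E →L[ℂ] E) - φ.smulRight e) rfl
    (Ring.inverse (μ • (1 : E →L[ℂ] E) - ((1 : E →L[ℂ] E) - φ.smulRight e) * t * ((1 : E →L[ℂ] E) - φ.smulRight e)))
    (Ring.inverse_mul_cancel _ hU) (Ring.mul_inverse_cancel _ hU)
    (φ.comp (t * ((1 : E →L[ℂ] E) - φ.smulRight e))) rfl (((1 : E →L[ℂ] E) - φ.smulRight e) (t e)) rfl hfix

end Summit.HubbardSuperconductivity.HubbardSuperconductivity.Theorems.TEnd
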